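import Summits.Ventures.CertifiedManyBodySolver.Rows.HomTorusMagModel
import Summits.Ventures.CertifiedManyBodySolver.Rows.OrbGaugeAut
import HarnessLib

/-!
# Spin-twisted torus ceiling II — Peierls phases PER SPECIES on the torus generated by hop vectors

HONEST FRAMING: first certified bounds; not a superconductivity verdict; every number certified or
labelled float.
`Rows/HomTorusMagModel.lean` with a bond phase `A x i σ ∈ U(1)` that may depend on the SPIN `σ`:
`H_A = −t Σ_{x,i,σ} (A_{x,i,σ} c†_{x+φeᵢ,σ} c_{x,σ} + h.c.) + U Σ n↑ n↓`.  A uniform field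
`A x i σ = κ i σ` is the SPIN-TWISTED torus (seam factor `κ_{iσ}^{L_i}` for species `σ` through the
cycle of direction `i`): Shastry–Sutherland's spin-dependent twisted boundary conditions (charge AND
spin stiffness).  This file: the model, Hermiticity, `U(1)↑ × U(1)↓` symmetry, covariance under the
ORBITAL gauge `W_g`, `g : site × spin → U(1)` (`Rows/OrbGaugeAut.lean`), translation covariance for
translation-invariant `A`, and `H_A = homHubbardMag φ A` for spin-blind `A`.
[cite: ShastrySutherland1990] [cite: Lieb1994, eq. (1)] [cite: FriedliVelenik2017, §3.1]
-/

noncomputable section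

open Matrix Finset
open Literature.MathematicalPhysics.QuantumLattice
open Literature.MathematicalPhysics.QuantumFieldTheory hiding Site
open Literature.MathematicalPhysics.QuantumManyBody.StateRelaxation
open Literature.Probability.LatticeModels
open HubbardWave0
open scoped ComplexOrder ComplexConjugate

namespace Summit.Ventures.CertifiedManyBodySolver.Rows

section SpinMagModel

variable {d d' N : ℕ} [NeZero N] (φ : Site d →+ TorusSite d' N)

/-- Elaborate torus identities with the order-derived `DecidableEq` (the convention of the tree's
torus files `FockRelabel`, `FluxTorusSymmetries`, `TorusCeilingHom`, `HomTorusMagModel`). -/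
local instance (priority := high) instDecidableEqFermionTorusHomSpinMag : DecidableEq (FermionTorus d' N) :=
  LinearOrder.toDecidableEq

/-! ### §1. The species-dependent Peierls Hamiltonian -/

/-- **Peierls Hubbard Hamiltonian with spin-dependent bond phases** on the torus generated by `φ`:
`H_A = −t Σ_{x,i,σ} (A_{x,i,σ} c†_{x+φeᵢ,σ} c_{x,σ} + conj A_{x,i,σ} c†_{x,σ} c_{x+φeᵢ,σ}) + U Σ_y n_{y↑} n_{y↓}`.
[cite: ShastrySutherland1990] [cite: Lieb1994, eq. (1)] -/
def homHubbardSpinMag (A : TorusSite d' N → Fin d → Fin 2 → Circle) (t U : ℝ) :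
    Matrix (Finset (Orb (FermionTorus d' N))) (Finset (Orb (FermionTorus d' N))) ℂ :=
  -(t : ℂ) • (∑ x : TorusSite d' N, ∑ i : Fin d, ∑ σ : Fin 2,
      (((A x i σ : Circle) : ℂ) •
          (creation (orb (FermionTorus.ofTorusSite (x + φ (unitVec i))) σ) *
            annihilation (orb (FermionTorus.ofTorusSite x) σ)) +
        conj ((A x i σ : Circle) : ℂ) •
          (creation (orb (FermionTorus.ofTorusSite x) σ) *
            annihilation (orb (FermionTorus.ofTorusSite (x + φ (unitVec i))) σ)))) +
    (U : ℂ) • ∑ y : FermionTorus d' N, numberOp y 0 * numberOp y 1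

/-- **Spin-blind phases give back the Peierls Hamiltonian of Part VI.** [cite: Lieb1994, eq. (1)] -/
theorem homHubbardSpinMag_spinBlind (A : TorusSite d' N → Fin d → Circle) (t U : ℝ) :
    homHubbardSpinMag φ (fun x i _ => A x i) t U = homHubbardMag φ A t U := rfl

/-- `H_A` is Hermitian. [cite: Lieb1994, eq. (1)] -/
theorem homHubbardSpinMag_isHermitian (A : TorusSite d' N → Fin d → Fin 2 → Circle) (t U : ℝ) :
    (homHubbardSpinMag φ A t U).IsHermitian := by
  unfold homHubbardSpinMag Matrix.IsHermitian
  rw [conjTranspose_add, conjTranspose_smul, conjTranspose_smul, conjTranspose_sum_numberOp_mul_numberOp]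
  simp only [conjTranspose_sum, conjTranspose_add, conjTranspose_smul,
    conjTranspose_creation_mul_annihilation, Complex.star_def, map_neg, Complex.conj_ofReal,
    Complex.conj_conj]
  refine congrArg₂ (fun S T => -(t : ℂ) • S + (U : ℂ) • T) ?_ rfl
  exact Finset.sum_congr rfl fun x _ => Finset.sum_congr rfl fun i _ =>
    Finset.sum_congr rfl fun σ _ => add_comm _ _

/-- `H_A` conserves `N↑` and `N↓`. [cite: Lieb1994, eq. (1)] -/
theorem preservesSectors_homHubbardSpinMag (A : TorusSite d' N → Fin d → Fin 2 → Circle) (t U : ℝ) :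
    PreservesSectors (homHubbardSpinMag φ A t U) := by
  unfold homHubbardSpinMag
  refine PreservesSectors.add (PreservesSectors.smul (PreservesSectors.sum fun x _ =>
    PreservesSectors.sum fun i _ => PreservesSectors.sum fun σ _ =>
      PreservesSectors.add (PreservesSectors.smul (LiebThm1.preservesSectors_hopping _ _ σ) _)
        (PreservesSectors.smul (LiebThm1.preservesSectors_hopping _ _ σ) _)) _)
    (PreservesSectors.smul (PreservesSectors.sum fun y _ =>
      (LiebThm1.preservesSectors_numberOp y 0).mul (LiebThm1.preservesSectors_numberOp y 1)) _)

/-- `[H_A, N̂] = 0`. [cite: Lieb1994, eq. (1)] -/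
theorem homHubbardSpinMag_commute_totalNumber (A : TorusSite d' N → Fin d → Fin 2 → Circle) (t U : ℝ) :
    Commute (homHubbardSpinMag φ A t U) (totalNumber : Matrix (Finset (Orb (FermionTorus d' N))) _ ℂ) := by
  rw [LiebThm1.totalNumber_eq_diagonal]
  exact (preservesSectors_homHubbardSpinMag φ A t U).commute_diagonal fun a b => ((a + b : ℕ) : ℂ)

/-- `[H_A, S^z] = 0`. [cite: Lieb1994, eq. (1)] -/
theorem homHubbardSpinMag_commute_spinZ (A : TorusSite d' N → Fin d → Fin 2 → Circle) (t U : ℝ) :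
    Commute (homHubbardSpinMag φ A t U) (HubbardWave0.spinZ : Matrix (Finset (Orb (FermionTorus d' N))) _ ℂ) := by
  rw [LiebThm1.spinZ_eq_diagonal]
  exact (preservesSectors_homHubbardSpinMag φ A t U).commute_diagonal fun a b => (1 / 2 : ℂ) * ((a : ℂ) - (b : ℂ))

/-- `H_A` preserves every joint sector `(N, S^z)`. [cite: Lieb1994, eq. (1)] -/
theorem mulVec_homHubbardSpinMag_mem_szSector (A : TorusSite d' N → Fin d → Fin 2 → Circle) (t U : ℝ) {n : ℕ} {M : ℝ}
    {ψ : Fock (Orb (FermionTorus d' N))} (hψ : ψ ∈ szSector n M) :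
    homHubbardSpinMag φ A t U *ᵥ ψ ∈ szSector n M :=
  mulVec_mem_szSector_of_commute (homHubbardSpinMag_commute_totalNumber φ A t U)
    (homHubbardSpinMag_commute_spinZ φ A t U) hψ

/-! ### §2. Covariance under the orbital gauge `W_g`, `g : site × spin → U(1)` -/

/-- **Orbital gauge transformation of spin-dependent bond phases**:
`(g·A) x i σ = g(x,σ) A x i σ g(x + φeᵢ, σ)⁻¹`. [cite: Lieb1994, eq. (1)] -/
def homSpinGaugeTransform (g : TorusSite d' N → Fin 2 → Circle) (A : TorusSite d' N → Fin d → Fin 2 → Circle) :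
    TorusSite d' N → Fin d → Fin 2 → Circle :=
  fun x i σ => g x σ * A x i σ * (g (x + φ (unitVec i)) σ)⁻¹

omit [NeZero N] in
/-- `g⁻¹ · (g · A) = A`. [cite: Lieb1994, eq. (1)] -/
theorem homSpinGaugeTransform_inv_homSpinGaugeTransform (g : TorusSite d' N → Fin 2 → Circle)
    (A : TorusSite d' N → Fin d → Fin 2 → Circle) :
    homSpinGaugeTransform φ g⁻¹ (homSpinGaugeTransform φ g A) = A := by
  funext x i σ
  simp only [homSpinGaugeTransform, Pi.inv_apply]
  group

/-- The orbital phase on the fermionic torus induced by `g : site × spin → U(1)`. -/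
def spinSitePhase (g : TorusSite d' N → Fin 2 → Circle) : Orb (FermionTorus d' N) → Circle :=
  fun o => g (ofLex o).1.toTorusSite (ofLex o).2

omit [NeZero N] in
/-- `spinSitePhase` on an orbital. [folklore] -/
@[simp] theorem spinSitePhase_orb (g : TorusSite d' N → Fin 2 → Circle) (u : FermionTorus d' N) (σ : Fin 2) :
    spinSitePhase g (orb u σ) = g u.toTorusSite σ := rfl

omit [NeZero N] in
/-- `spinSitePhase` is a group homomorphism (inverse). [folklore] -/
theorem spinSitePhase_inv (g : TorusSite d' N → Fin 2 → Circle) :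
    spinSitePhase g⁻¹ = (spinSitePhase g)⁻¹ := rfl

/-- **Gauge covariance** `W_g H_A W_gᴴ = H_{g⁻¹·A}` for the ORBITAL gauge `W_g = orbPhaseGauge (spinSitePhase g)`.
[cite: Lieb1994, eq. (1)] [cite: KomaTasakiPRL1992, eqs. (7)–(8)] -/
theorem orbPhaseGauge_mul_homHubbardSpinMag_mul_conjTranspose (g : TorusSite d' N → Fin 2 → Circle)
    (A : TorusSite d' N → Fin d → Fin 2 → Circle) (t U : ℝ) :
    orbPhaseGauge (spinSitePhase g) * homHubbardSpinMag φ A t U * (orbPhaseGauge (spinSitePhase g))ᴴ =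
      homHubbardSpinMag φ (homSpinGaugeTransform φ g⁻¹ A) t U := by
  have hnumσ : ∀ (y : FermionTorus d' N) (σ : Fin 2),
      orbPhaseGauge (spinSitePhase g) * numberOp y σ * (orbPhaseGauge (spinSitePhase g))ᴴ = numberOp y σ := by
    intro y σ
    rw [numberOp, orbPhaseGauge_mul_mul_mul_conjTranspose, orbPhaseGauge_mul_creation_mul_conjTranspose,
      orbPhaseGauge_mul_annihilation_mul_conjTranspose, smul_mul_smul, Complex.mul_conj, Circle.normSq_coe,
      Complex.ofReal_one, one_smul]
  have hnum : ∀ y : FermionTorus d' N,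
      orbPhaseGauge (spinSitePhase g) * (numberOp y 0 * numberOp y 1) *
        (orbPhaseGauge (spinSitePhase g))ᴴ = numberOp y 0 * numberOp y 1 := by
    intro y
    rw [orbPhaseGauge_mul_mul_mul_conjTranspose, hnumσ, hnumσ]
  unfold homHubbardSpinMag
  rw [Matrix.mul_add, Matrix.add_mul, Matrix.mul_smul, Matrix.smul_mul, Matrix.mul_smul,
    Matrix.smul_mul, Finset.mul_sum, Finset.sum_mul, Finset.mul_sum, Finset.sum_mul]
  simp only [hnum]
  congr 2
  refine Finset.sum_congr rfl fun x _ => ?_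
  rw [Finset.mul_sum, Finset.sum_mul]
  refine Finset.sum_congr rfl fun i _ => ?_
  rw [Finset.mul_sum, Finset.sum_mul]
  refine Finset.sum_congr rfl fun σ _ => ?_
  rw [Matrix.mul_add, Matrix.add_mul, Matrix.mul_smul, Matrix.smul_mul, Matrix.mul_smul,
    Matrix.smul_mul, orbPhaseGauge_mul_mul_mul_conjTranspose, orbPhaseGauge_mul_creation_mul_conjTranspose,
    orbPhaseGauge_mul_annihilation_mul_conjTranspose, smul_mul_smul, smul_smul,
    orbPhaseGauge_mul_mul_mul_conjTranspose, orbPhaseGauge_mul_creation_mul_conjTranspose,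
    orbPhaseGauge_mul_annihilation_mul_conjTranspose, smul_mul_smul, smul_smul]
  simp only [spinSitePhase_orb, FermionTorus.toTorusSite_ofTorusSite, homSpinGaugeTransform, Pi.inv_apply,
    inv_inv, Circle.coe_mul, Circle.coe_inv_eq_conj, map_mul, Complex.conj_conj]
  congr 2
  · ring
  · ring

/-- **`H_{g·A} = W_gᴴ H_A W_g`.** [cite: Lieb1994, eq. (1)] -/
theorem homHubbardSpinMag_homSpinGaugeTransform (g : TorusSite d' N → Fin 2 → Circle)
    (A : TorusSite d' N → Fin d → Fin 2 → Circle) (t U : ℝ) :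
    homHubbardSpinMag φ (homSpinGaugeTransform φ g A) t U =
      (orbPhaseGauge (spinSitePhase g))ᴴ * homHubbardSpinMag φ A t U * orbPhaseGauge (spinSitePhase g) := by
  have h := orbPhaseGauge_mul_homHubbardSpinMag_mul_conjTranspose φ g⁻¹ A t U
  rw [inv_inv] at h
  rw [← h, spinSitePhase_inv, orbPhaseGauge_conjTranspose, orbPhaseGauge_conjTranspose, inv_inv]

/-- **Gauge invariance of the sector energies**: `H_{g·A}` and `H_A` have the same lowest energy in
every joint sector `(N, S^z)`. [cite: Lieb1994, eq. (1)] -/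
theorem minEnergyOn_szSector_homSpinGaugeTransform (g : TorusSite d' N → Fin 2 → Circle)
    (A : TorusSite d' N → Fin d → Fin 2 → Circle) (t U : ℝ) (n : ℕ) (M : ℝ) :
    (homHubbardSpinMag φ (homSpinGaugeTransform φ g A) t U).minEnergyOn (szSector n M) =
      (homHubbardSpinMag φ A t U).minEnergyOn (szSector n M) := by
  rw [homHubbardSpinMag_homSpinGaugeTransform]
  exact minEnergyOn_szSector_orbPhaseGauge_conj _ _ n M

/-- A gauge transformation CONSTANT IN SPACE (one phase per species, e.g. a rotation about `S^z`)
commutes with `H_A`. [cite: Lieb1994, eq. (1)] -/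
theorem orbPhaseGauge_constSpin_mul_homHubbardSpinMag (c : Fin 2 → Circle)
    (A : TorusSite d' N → Fin d → Fin 2 → Circle) (t U : ℝ) :
    orbPhaseGauge (spinSitePhase (fun _ : TorusSite d' N => c)) * homHubbardSpinMag φ A t U =
      homHubbardSpinMag φ A t U * orbPhaseGauge (spinSitePhase (fun _ : TorusSite d' N => c)) := by
  have h := orbPhaseGauge_mul_homHubbardSpinMag_mul_conjTranspose φ (fun _ : TorusSite d' N => c) A t U
  have hg : homSpinGaugeTransform φ (fun _ : TorusSite d' N => c)⁻¹ A = A := by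
    funext x i σ
    simp only [homSpinGaugeTransform, Pi.inv_apply, inv_inv]
    rw [mul_comm (c σ)⁻¹ (A x i σ), mul_assoc, inv_mul_cancel, mul_one]
  rw [hg] at h
  have h2 := congrArg (fun M => M * orbPhaseGauge (spinSitePhase (fun _ : TorusSite d' N => c))) h
  simp only at h2
  rw [Matrix.mul_assoc, orbPhaseGauge_conjTranspose_mul_self, Matrix.mul_one] at h2
  exact h2

/-- `H_A` with the interaction re-indexed over torus sites. [cite: Lieb1994, eq. (1)] -/
theorem homHubbardSpinMag_eq_sum_torusSite (A : TorusSite d' N → Fin d → Fin 2 → Circle) (t U : ℝ) :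
    homHubbardSpinMag φ A t U =
      -(t : ℂ) • (∑ x : TorusSite d' N, ∑ i : Fin d, ∑ σ : Fin 2,
        (((A x i σ : Circle) : ℂ) •
            (creation (orb (FermionTorus.ofTorusSite (x + φ (unitVec i))) σ) *
              annihilation (orb (FermionTorus.ofTorusSite x) σ)) +
          conj ((A x i σ : Circle) : ℂ) •
            (creation (orb (FermionTorus.ofTorusSite x) σ) *
              annihilation (orb (FermionTorus.ofTorusSite (x + φ (unitVec i))) σ)))) +
      (U : ℂ) • ∑ x : TorusSite d' N,
        numberOp (FermionTorus.ofTorusSite x) 0 * numberOp (FermionTorus.ofTorusSite x) 1 := by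
  unfold homHubbardSpinMag
  exact congrArg₂ (fun S T => -(t : ℂ) • S + (U : ℂ) • T) rfl
    (Fintype.sum_equiv FermionTorus.equivTorusSite.symm
      (fun x : TorusSite d' N => numberOp (FermionTorus.ofTorusSite x) 0 * numberOp (FermionTorus.ofTorusSite x) 1)
      (fun y : FermionTorus d' N => numberOp y 0 * numberOp y 1) fun _ => rfl).symm

/-- **Spin-blind uniform field `1`**: `H_1 = homHubbard φ` for non-degenerate hops. [cite: Lieb1994, eq. (1)] -/
theorem homHubbardSpinMag_one_eq_homHubbard (hd : Function.Injective (signedHop φ)) (t U : ℝ) :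
    homHubbardSpinMag φ 1 t U = homHubbard φ t U := by
  rw [← homHubbardMag_one_eq_homHubbard φ hd t U]
  rfl

/-! ### §3. Translation covariance (translation-invariant phases) -/

/-- **Translation covariance**: for a translation-invariant field (`A (x + v) = A x`) the torus
translation by `v` fixes `H_A`. [cite: FriedliVelenik2017, §3.1] -/
theorem relabel_translate_homHubbardSpinMag (v : TorusSite d' N) (A : TorusSite d' N → Fin d → Fin 2 → Circle)
    (hA : ∀ x i, A (x + v) i = A x i) (t U : ℝ) :
    relabel (Orb.translate v) (homHubbardSpinMag φ A t U) = homHubbardSpinMag φ A t U := by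
  unfold homHubbardSpinMag
  rw [relabel_add, relabel_smul, relabel_smul, relabel_sum, relabel_sum]
  refine congrArg₂ (fun S T => -(t : ℂ) • S + (U : ℂ) • T) ?_ ?_
  · refine Fintype.sum_equiv (Equiv.addRight v) _ _ fun x => ?_
    simp only [Equiv.coe_addRight, relabel_sum, relabel_add, relabel_smul, relabel_mul,
      relabel_translate_creation, relabel_translate_annihilation, hA]
    refine Finset.sum_congr rfl fun i _ => ?_
    rw [add_right_comm x v (φ (unitVec i))]
  · refine Fintype.sum_equiv (FermionTorus.ofTorusEquiv (Equiv.addRight v)) _ _ fun y => ?_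
    rw [relabel_mul, Orb.translate, relabel_mapEquiv_numberOp, relabel_mapEquiv_numberOp]

/-- The torus translations commute with `H_κ` for a UNIFORM spin-dependent field `κ`.
[cite: FriedliVelenik2017, §3.1] -/
theorem fockTranslate_mul_homHubbardSpinMag_const (v : TorusSite d' N) (κ : Fin d → Fin 2 → Circle) (t U : ℝ) :
    (fockTranslate v).val * homHubbardSpinMag φ (fun _ => κ) t U =
      homHubbardSpinMag φ (fun _ => κ) t U * (fockTranslate v).val :=
  (fockRelabel_commute_of_relabel_eq _
    (relabel_translate_homHubbardSpinMag φ v (fun _ => κ) (fun _ _ => rfl) t U)).eq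

end SpinMagModel

end Summit.Ventures.CertifiedManyBodySolver.Rows
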